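import Mathlib

/-!
# Chain calculus for crux `ElementaryWordLength.WordPerSuperQuartic`, line `Sketch`:
# the coefficient recursion of a chain

A *chain* is a product `Π_t (1 + x_{v_t} • N_t)` of `3 × 3` matrices over `MvPolynomial σ ℂ`,
one factor per letter `e = (v_t, N_t)` of a list `L` (variable `e.1`, constant matrix `e.2`).
Write `K_m(L)` for the `3 × 3` complex matrix of `x^m`-coefficients of the chain of `L`, for an
arbitrary exponent vector `m : σ →₀ ℕ`.  Peeling off the first factor,
`(1 + x_v • N) * M = M + x_v • (N * M)`, and since `coeff m (x_v * p) = [m v ≠ 0] · coeff (m - e_v) p`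
(`MvPolynomial.coeff_X_mul'`) and `coeff n (C c * p) = c * coeff n p` (`MvPolynomial.coeff_C_mul`),
the coefficient matrices satisfy the recursion

`K_m(e :: L) = K_m(L) + [m (e.1) ≠ 0] · e.2 * K_{m - e_{e.1}}(L)`,

which is `chain_coeff_cons` below (the multilinear special case is the private `coeffMatrix_cons`
of `Theorems/ElementaryWordLengthWordPerSuperQuarticChainLayer.lean`).  Only `Mathlib` is used.
-/

-- `Summit.ValiantsHypothesis.ValiantsHypothesis.…` is the tree's mandated single-conjunct layout.
set_option linter.dupNamespace false

namespace Summit.ValiantsHypothesis.ValiantsHypothesis.Theorems.WordPerSuperQuartic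

open MvPolynomial

/-- **Coefficient recursion of a chain.**  For every exponent vector `m`, the `x^m`-coefficient
matrix of the chain of `e :: L` is that of the chain of `L`, plus, when `x_{e.1}` divides `x^m`,
`e.2` times the `x^m / x_{e.1}`-coefficient matrix of the chain of `L`:
`K_m(e :: L) = K_m(L) + [m (e.1) ≠ 0] · e.2 * K_{m - e_{e.1}}(L)`. -/
theorem chain_coeff_cons : ∀ {σ : Type} [DecidableEq σ] (e : σ × Matrix (Fin 3) (Fin 3) ℂ)
    (L : List (σ × Matrix (Fin 3) (Fin 3) ℂ)) (m : σ →₀ ℕ),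
    (((e :: L).map (fun e => (1 : Matrix (Fin 3) (Fin 3) (MvPolynomial σ ℂ)) +
        (MvPolynomial.X e.1 : MvPolynomial σ ℂ) •
          e.2.map (MvPolynomial.C : ℂ → MvPolynomial σ ℂ))).prod).map (MvPolynomial.coeff m) =
      ((L.map (fun e => (1 : Matrix (Fin 3) (Fin 3) (MvPolynomial σ ℂ)) +
        (MvPolynomial.X e.1 : MvPolynomial σ ℂ) •
          e.2.map (MvPolynomial.C : ℂ → MvPolynomial σ ℂ))).prod).map (MvPolynomial.coeff m) +
      (if m e.1 = 0 then 0 else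
        e.2 * ((L.map (fun e => (1 : Matrix (Fin 3) (Fin 3) (MvPolynomial σ ℂ)) +
          (MvPolynomial.X e.1 : MvPolynomial σ ℂ) •
            e.2.map (MvPolynomial.C : ℂ → MvPolynomial σ ℂ))).prod).map
              (MvPolynomial.coeff (m - Finsupp.single e.1 1))) := by
  intro σ _ e L m
  rw [List.map_cons, List.prod_cons, Matrix.add_mul, Matrix.one_mul, Matrix.smul_mul]
  ext a b
  simp only [Matrix.map_apply, Matrix.add_apply, Matrix.smul_apply, smul_eq_mul, coeff_add,
    Matrix.ite_apply, Matrix.zero_apply, Matrix.mul_apply]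
  congr 1
  rw [coeff_X_mul']
  by_cases h : m e.1 = 0
  · rw [if_neg (by rwa [Finsupp.mem_support_iff, not_not]), if_pos h]
  · rw [if_pos (Finsupp.mem_support_iff.mpr h), if_neg h, coeff_sum]
    simp only [coeff_C_mul]

end Summit.ValiantsHypothesis.ValiantsHypothesis.Theorems.WordPerSuperQuartic
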